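import Mathlib.RingTheory.Valuation.ValuationSubring
import Mathlib.RingTheory.Valuation.Integral
import Mathlib.RingTheory.IntegralClosure.IsIntegralClosure.Basic
import Mathlib.RingTheory.LocalRing.ResidueField.Basic
import HarnessLib

/-!
# Algebra maps from an integral algebra into a valuation subring versus into the field; residue maps with prescribed kernel
# ([StacksProject] Tag 00U3, Tag 052K; glue for the (S-γ2) count «generic points ↔ `V`-points ↔ `Ω`-points»)

Topic `Literature/RingTheory/Valuation`.  THEOREMS only (no def, no instance, no notation, no named fact, no `sorry`).  Cell `hodgecm-mathlib` (D-0151),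
FLOOR 0, programme F0P5a, crux item stmt-HodgeConjecture-24832 — two elementary dictionaries used by the final (S-γ2) count (desk
`F0/P5a/S-gamma2-DESK.v0` §2; F0P5a LEAD WORDS #11/#12):

* §1 `ValuationSubring.range_algHom_le` / `nonempty_algHom_equiv_algHom_subtype` — for `V ⊆ Ω` a valuation subring and `C` an INTEGRAL
  commutative `V`-algebra, every `V`-algebra map `C → Ω` lands in `V` (`V` is integrally closed in `Ω`), so `(C →ₐ[V] V) ≃ (C →ₐ[V] Ω)`
  and the two point counts agree (`Nat.card`): the `Ω`-points counted by ★ `Literature.RingTheory.Etale.card_algHom_eq_finrank_of_isReduced_baseChange`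
  (F0P5a-p01 (g2)) ARE the integral points of ★ p799041/p799183.
* §2 `IsLocalRing.residue_comp_eq_iff_ker_eq` — for `R` local with residue field `κ` and `ψ : C →ₐ[R] R`, `χ : C →ₐ[R] κ`:
  `residue ∘ ψ = χ` IFF `ker (residue ∘ ψ) = ker χ` (both are `R`-algebra maps onto `κ = R ∕ 𝔪`); this turns «integral points with prescribed
  specialisation» (★ p799183) into «integral points with prescribed reduction ideal» (★ p799045).

HC_CM is proved only modulo the 7 printed citations until rung 0 closes; this file is a generic leaf and changes no count.

## References
* [StacksProject] The Stacks Project, Tag 052K (valuation rings are integrally closed / normal), Tag 00U3 (points and residue fields).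
-/

set_option autoImplicit false

/-! ### §1 Maps into `Ω` from an integral `V`-algebra land in `V` -/

namespace ValuationSubring

variable {Ω : Type*} [Field Ω] (V : ValuationSubring Ω) {C : Type*} [CommRing C] [Algebra V C]

/-- A valuation subring is integrally closed in its field: an element of `Ω` integral over `V` lies in `V`. [cite: StacksProject, Tag 052K] -/
theorem mem_of_isIntegral {z : Ω} (hz : IsIntegral V z) : z ∈ V := by
  have hIC : IsIntegrallyClosed V := by
    have h := Valuation.Integers.isIntegrallyClosed (Valuation.valuationSubring.integers (v := V.valuation))
    rwa [ValuationSubring.valuationSubring_valuation] at h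
  obtain ⟨y, hy⟩ := (IsIntegrallyClosed.isIntegral_iff (R := V) (K := Ω)).mp hz
  rw [← hy]; exact y.2

/-- Every `V`-algebra map from an INTEGRAL `V`-algebra into `Ω` takes values in `V`. [cite: StacksProject, Tag 052K] -/
theorem apply_mem_of_isIntegral [Algebra.IsIntegral V C] (φ : C →ₐ[V] Ω) (c : C) : φ c ∈ V :=
  V.mem_of_isIntegral ((Algebra.IsIntegral.isIntegral (R := ↥V) c).map φ)

/-- **`(C →ₐ[V] V) ≃ (C →ₐ[V] Ω)`** for `C` integral over the valuation subring `V ⊆ Ω`: composing with the inclusion is a bijection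
(restrict the codomain for the inverse); the equivalence `e` satisfies `e ψ c = ψ c` in `Ω`. [cite: StacksProject, Tag 052K] -/
theorem exists_algHom_equiv_algHom [Algebra.IsIntegral V C] :
    ∃ e : (C →ₐ[V] V) ≃ (C →ₐ[V] Ω), ∀ ψ c, e ψ c = ((ψ c : V) : Ω) := by
  let back : (C →ₐ[V] Ω) → (C →ₐ[V] V) := fun φ =>
    { toFun := fun c => ⟨φ c, V.apply_mem_of_isIntegral φ c⟩
      map_one' := Subtype.ext (by simp)
      map_mul' := fun a b => Subtype.ext (by simp)
      map_zero' := Subtype.ext (by simp)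
      map_add' := fun a b => Subtype.ext (by simp)
      commutes' := fun r => Subtype.ext (by simp) }
  refine ⟨{ toFun := fun ψ => (IsScalarTower.toAlgHom V V Ω).comp ψ
            invFun := back
            left_inv := fun ψ => by apply AlgHom.ext; intro c; rfl
            right_inv := fun φ => by apply AlgHom.ext; intro c; rfl }, fun ψ c => rfl⟩

/-- … hence the two point counts agree. [cite: StacksProject, Tag 052K] -/
theorem card_algHom_eq_card_algHom_field [Algebra.IsIntegral V C] : Nat.card (C →ₐ[V] V) = Nat.card (C →ₐ[V] Ω) := by
  obtain ⟨e, -⟩ := V.exists_algHom_equiv_algHom (C := C)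
  exact Nat.card_congr e

/-- The same for the points taking the value `1` at an element `u` (the points of a corner). [cite: StacksProject, Tag 052K] -/
theorem card_algHom_apply_eq_one_eq [Algebra.IsIntegral V C] (u : C) :
    Nat.card {ψ : C →ₐ[V] V // ψ u = 1} = Nat.card {φ : C →ₐ[V] Ω // φ u = 1} := by
  obtain ⟨e, he⟩ := V.exists_algHom_equiv_algHom (C := C)
  refine Nat.card_congr (e.subtypeEquiv fun ψ => ?_)
  rw [he ψ u, ← OneMemClass.coe_one (V.toSubring), Subtype.coe_inj]

/-- `(C →ₐ[V] V)` is finite when `(C →ₐ[V] Ω)` is (e.g. `C` module-finite free, Mathlib `Finite.algHom`). [cite: StacksProject, Tag 052K] -/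
theorem finite_algHom_of_finite [Algebra.IsIntegral V C] [Finite (C →ₐ[V] Ω)] : Finite (C →ₐ[V] V) := by
  obtain ⟨e, -⟩ := V.exists_algHom_equiv_algHom (C := C)
  exact Finite.of_equiv _ e.symm

end ValuationSubring

/-! ### §2 Residue of an integral point with prescribed value -/

namespace IsLocalRing

variable {R C : Type*} [CommRing R] [IsLocalRing R] [CommRing C] [Algebra R C]

/-- **`residue ∘ ψ = χ ↔ ker (residue ∘ ψ) = ker χ`** for `R`-algebra maps `ψ : C → R`, `χ : C → κ(R)` (`R` local): both sides of the first
equation are `R`-algebra maps onto `κ(R) = R ∕ 𝔪`, determined by their kernels. [cite: StacksProject, Tag 00U3] -/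
theorem residue_comp_eq_iff_ker_eq (ψ : C →ₐ[R] R) (χ : C →ₐ[R] ResidueField R) :
    (residue R).comp (ψ : C →+* R) = (χ : C →+* ResidueField R) ↔
      RingHom.ker ((residue R).comp (ψ : C →+* R)) = RingHom.ker (χ : C →+* ResidueField R) := by
  constructor
  · intro h; rw [h]
  · intro h
    ext c
    rw [RingHom.comp_apply, RingHom.coe_coe, RingHom.coe_coe]
    -- `χ c = residue r` for some `r`, so `c - r·1 ∈ ker χ = ker (residue ∘ ψ)`
    obtain ⟨r, hr⟩ := residue_surjective (χ c)
    have hmem : c - algebraMap R C r ∈ RingHom.ker (χ : C →+* ResidueField R) := by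
      rw [RingHom.mem_ker, map_sub, RingHom.coe_coe, AlgHom.commutes, IsLocalRing.ResidueField.algebraMap_eq, ← hr, sub_self]
    rw [← h, RingHom.mem_ker, map_sub, sub_eq_zero, RingHom.comp_apply, RingHom.comp_apply, RingHom.coe_coe] at hmem
    rw [hmem, AlgHom.commutes, Algebra.algebraMap_self, RingHom.id_apply, hr]

end IsLocalRing
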